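import Literature.MathematicalPhysics.QuantumLattice.InfVolFermionStateStepWords
import Literature.MathematicalPhysics.QuantumLattice.DWaveSourceNNNHoppingTwisted
import Literature.MathematicalPhysics.QuantumLattice.TorusLimitPointGroupCovariance
import HarnessLib

/-!
# The pair-sourced `t–t'` Hubbard mean energy and the `d`-wave local pair amplitude are INVARIANT under the
# gauge-twisted `D₄ × ℤ₂^{flip}` transforms of translation-invariant states

Topic `Literature/MathematicalPhysics/QuantumLattice` (namespace = path); cell `hubbard-cq`, seat `hubbard-cq-obsth-1`.
Sequel of `InfVolFermionStateTwistedFlipAction` (`α_g = twistedFlipAct g`, `g = ((γ, f), m)`) and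
`InfVolFermionStateStepWords` (the two-site words and the step-sum form of the energies). This is the «WLOG by
averaging» step of the cell's sourced-menu node sentences (engine obsb ≥ 0.3.0 `Canon(gauge_twist, D4, spin_flip)`:
«this 16-element group fixes `h₀ / a₀` (d-wave source included), the filling rows and `√2·Δ_d(x)`») as THEOREMS on
infinite-volume states: for every index `g` and every translation-invariant `ω`,
* `e^{tt'}(α_g ω) = e^{tt'}(ω)` (`IsTranslationInvariant.meanEnergy_hubbardTTPrime_twistedFlipAct`: docc fixed, bond sums re-indexed);
* `(α_g ω)(P₀^d) = ω(P₀^d)` for EVERY state (`twistedFlipAct_expect_localPairAt_dWave`: the `B₁g` sign of `γ`, the sign of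
  the flip and the gauge phase `(−1)^{j(γ)+f+2m}` of the charge-`−2` pair cancel, `neg_one_pow_twistFlipExp_mul_neg_one_pow_mul_b1gChar`);
* hence `e^{src}_h(α_g ω) = e^{src}_h(ω)` for the Koma–Tasaki sourced interaction
  `hubbardTTPrimeSourcedInteraction t t' U μ dWaveFormFactor h` (`…meanEnergy_hubbardTTPrimeSourced_twistedFlipAct`), the ORBIT SUMS
  `Σ_g e^{src}(α_g ω) = 32 e^{src}(ω)`, `Σ_g e^{tt'}(α_g ω) = 32 e^{tt'}(ω)`, `Σ_g Re (α_g ω)(P₀^d) = 32 Re ω(P₀^d)`, and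
  `IsMeanEnergyMinimiser.twistedFlipAct` (minimisers may be symmetrised).
Everything is PROVED; no definition, no named fact, no number, no `sorry`.
Tree search: REUSED `twistedFlipAct(_expect/_density)`, `d4Act_expect_docc`, `gaugeAut_nAt`, `relabel_spinSwap_nAt`, `numberAt_commute`,
`meanEnergy_hubbardTTPrimeSourced`, `meanEnergy_pairSourceInteraction_dWave_eq`, `ofReal_dWaveFormFactor_d4Vec`,
`neg_one_pow_twistExp_mul_b1gChar`, `sum_unitSteps_d4Vec`, `sum_diagSteps_d4Vec`, `sum_insert_zero_unitSteps_d4Vec`;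
`lean search 'twistedFlipAct.*(meanEnergy|localPair)'`: nothing.

References: T. Koma, H. Tasaki, J. Stat. Phys. 76 (1994) 745, §1 (symmetry-breaking pair field) [cite: KomaTasaki1994, §1];
D. J. Scalapino, Phys. Rep. 250 (1995) 329, §2 eq. (2.3) (`B₁g` form factor) [cite: Scalapino1995, §2 eq. (2.3)];
H.-C. Xu et al., Science 384 (2024) eadh7691, eq. (1) (the `t–t'` Hubbard model) [cite: XuEtAl2024, eq. (1)];
O. Bratteli, A. Kishimoto, D. W. Robinson, CMP 64 (1978) 41, Thm. 2 (minimisers) [cite: BratteliKishimotoRobinson1978, Thm. 2].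
-/

noncomputable section

namespace Literature.MathematicalPhysics.QuantumLattice

open Matrix Finset Complex HubbardWave0 Literature.Probability.LatticeModels
open scoped ComplexOrder BigOperators

/-! ## §3 Invariance under the flip-twisted transforms -/

section Invariance

open InfVolFermionState

variable {ω : InfVolFermionState 2}

/-- `(α_g ω)(H_v) = ω(H_{γ_g v})` (every state). [cite: Han2020Bootstrap, §3] -/
theorem InfVolFermionState.twistedFlipAct_expect_hopWord (g : TwistFlipIndex) (ω : InfVolFermionState 2) (v : Site 2) :
    (ω.twistedFlipAct g).expect (stepPair v) (hopWord v) = ω.expect (stepPair (d4Vec g.1.1 v)) (hopWord (d4Vec g.1.1 v)) := by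
  rw [twistedFlipAct_expect, gaugeAut_hopWord, spinSwapIter_hopWord, d4Act_expect_hopWord]

/-- `(α_g ω)(b_v) = (−1)^{e(g)} (−1)^{f} ω(b_{γ_g v})` (every state). [cite: Han2020Bootstrap, §3] -/
theorem InfVolFermionState.twistedFlipAct_expect_singletWord (g : TwistFlipIndex) (ω : InfVolFermionState 2) (v : Site 2) :
    (ω.twistedFlipAct g).expect (stepPair v) (singletWord v) =
      ((-1 : ℂ) ^ twistFlipExp g.1.1 g.1.2 g.2 * (-1 : ℂ) ^ g.1.2.val) *
        ω.expect (stepPair (d4Vec g.1.1 v)) (singletWord (d4Vec g.1.1 v)) := by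
  rw [twistedFlipAct_expect, twistFlipAngle, gaugeAut_natCast_mul_pi_div_two_singletWord, spinSwapIter_smul,
    spinSwapIter_singletWord, smul_smul, map_smul, d4Act_expect_singletWord, smul_eq_mul]

/-- `(α_g ω)(n_{0↑}n_{0↓}) = ω(n_{0↑}n_{0↓})` (every state). [cite: Scalapino1995, §2] -/
theorem InfVolFermionState.twistedFlipAct_expect_docc (g : TwistFlipIndex) (ω : InfVolFermionState 2) :
    (ω.twistedFlipAct g).expect ({0} : Finset (Site 2)) (nAt 0 (mem_singleton_self 0) 0 * nAt 0 (mem_singleton_self 0) 1) =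
      ω.expect ({0} : Finset (Site 2)) (nAt 0 (mem_singleton_self 0) 0 * nAt 0 (mem_singleton_self 0) 1) := by
  have hsw : ∀ k : ℕ, spinSwapIter k (nAt 0 (mem_singleton_self (0 : Site 2)) 0 * nAt 0 (mem_singleton_self 0) 1) =
      nAt 0 (mem_singleton_self (0 : Site 2)) 0 * nAt 0 (mem_singleton_self 0) 1 := by
    intro k
    induction k with
    | zero => rfl
    | succ k ih =>
      rw [spinSwapIter_succ, ih, map_mul, relabel_spinSwap_nAt, relabel_spinSwap_nAt, Equiv.swap_apply_left,
        Equiv.swap_apply_right, nAt, nAt, ← numberAt_orb, ← numberAt_orb, (numberAt_commute _ _).eq]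
  rw [twistedFlipAct_expect, map_mul, gaugeAut_nAt, gaugeAut_nAt, hsw, d4Act_expect_docc]

/-- **`e^{tt'}(α_g ω) = e^{tt'}(ω)` for translation-invariant `ω`** (docc fixed, the bond sums re-indexed by `γ`).
[cite: XuEtAl2024, eq. (1)] -/
theorem InfVolFermionState.IsTranslationInvariant.meanEnergy_hubbardTTPrime_twistedFlipAct (hω : ω.IsTranslationInvariant)
    (g : TwistFlipIndex) (t t' U : ℝ) :
    (ω.twistedFlipAct g).meanEnergy (hubbardTTPrimeFermionInteraction t t' U) 1 =
      ω.meanEnergy (hubbardTTPrimeFermionInteraction t t' U) 1 := by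
  rw [(hω.twistedFlipAct g).meanEnergy_hubbardTTPrime_eq_stepSums, hω.meanEnergy_hubbardTTPrime_eq_stepSums,
    twistedFlipAct_expect_docc]
  simp_rw [twistedFlipAct_expect_hopWord]
  rw [sum_unitSteps_d4Vec g.1.1 (fun v => (ω.expect (stepPair v) (hopWord v)).re),
    sum_diagSteps_d4Vec g.1.1 (fun v => (ω.expect (stepPair v) (hopWord v)).re)]

/-- The sign bookkeeping: `(−1)^{j(γ)+f+2m} · (−1)^f · χ_{B₁g}(γ) = 1`. [cite: Scalapino1995, §2 eq. (2.3)] -/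
theorem neg_one_pow_twistFlipExp_mul_neg_one_pow_mul_b1gChar (γ : DihedralGroup 4) (f m : Fin 2) :
    (-1 : ℂ) ^ twistFlipExp γ f m * (-1 : ℂ) ^ f.val * b1gChar γ = 1 := by
  rw [show twistFlipExp γ f m = twistExp γ m + f.val by simp only [twistFlipExp, twistExp]; ring, pow_add, mul_assoc,
    mul_assoc, ← mul_assoc ((-1 : ℂ) ^ f.val), ← pow_add, ← two_mul, pow_mul, neg_one_sq, one_pow, one_mul,
    neg_one_pow_twistExp_mul_b1gChar]

/-- **`(α_g ω)(P₀^d) = ω(P₀^d)` for EVERY state**: the `B₁g` sign of the point operation, the sign of the spin exchange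
and the gauge phase on the charge-`−2` pair cancel (`P₀^d = localPairAt ({0} ∪ unitSteps) dWaveFormFactor 0`).
[cite: Scalapino1995, §2 eq. (2.3)] [cite: KomaTasaki1994, §1] -/
theorem InfVolFermionState.twistedFlipAct_expect_localPairAt_dWave (g : TwistFlipIndex) (ω : InfVolFermionState 2) :
    (ω.twistedFlipAct g).expect (pairRegion (insert (0 : Site 2) unitSteps) 0)
        (localPairAt (insert (0 : Site 2) unitSteps) dWaveFormFactor 0) =
      ω.expect (pairRegion (insert (0 : Site 2) unitSteps) 0) (localPairAt (insert (0 : Site 2) unitSteps) dWaveFormFactor 0) := by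
  set s : ℂ := (-1 : ℂ) ^ twistFlipExp g.1.1 g.1.2 g.2 * (-1 : ℂ) ^ g.1.2.val with hs
  have hsχ : s * b1gChar g.1.1 = 1 := neg_one_pow_twistFlipExp_mul_neg_one_pow_mul_b1gChar g.1.1 g.1.2 g.2
  have hχχ : b1gChar g.1.1 * b1gChar g.1.1 = 1 := by cases g.1.1 <;> simp [b1gChar, ← pow_add, ← two_mul, pow_mul]
  rw [expect_localPairAt_eq_sum_singletWord, expect_localPairAt_eq_sum_singletWord]
  simp_rw [twistedFlipAct_expect_singletWord, ← hs]
  -- `g_d(e) = χ(γ) g_d(γe)`; then re-index `e ↦ γe`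
  have hcoef : ∀ e : Site 2, ((dWaveFormFactor e / Real.sqrt 2 : ℝ) : ℂ) =
      b1gChar g.1.1 * ((dWaveFormFactor (d4Vec g.1.1 e) / Real.sqrt 2 : ℝ) : ℂ) := by
    intro e
    rw [Complex.ofReal_div, Complex.ofReal_div, ofReal_dWaveFormFactor_d4Vec, ← mul_div_assoc, ← mul_assoc, hχχ, one_mul]
  calc ∑ e ∈ insert (0 : Site 2) unitSteps, ((dWaveFormFactor e / Real.sqrt 2 : ℝ) : ℂ) *
        (s * ω.expect (stepPair (d4Vec g.1.1 e)) (singletWord (d4Vec g.1.1 e)))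
      = (s * b1gChar g.1.1) * ∑ e ∈ insert (0 : Site 2) unitSteps,
          ((dWaveFormFactor (d4Vec g.1.1 e) / Real.sqrt 2 : ℝ) : ℂ) *
            ω.expect (stepPair (d4Vec g.1.1 e)) (singletWord (d4Vec g.1.1 e)) := by
        rw [Finset.mul_sum]
        exact Finset.sum_congr rfl fun e _ => by rw [hcoef e]; ring
    _ = ∑ e ∈ insert (0 : Site 2) unitSteps, ((dWaveFormFactor e / Real.sqrt 2 : ℝ) : ℂ) *
          ω.expect (stepPair e) (singletWord e) := by
        rw [hsχ, one_mul]
        exact sum_insert_zero_unitSteps_d4Vec g.1.1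
          (fun e => ((dWaveFormFactor e / Real.sqrt 2 : ℝ) : ℂ) * ω.expect (stepPair e) (singletWord e))

/-- **`e^{src}_h(α_g ω) = e^{src}_h(ω)` for translation-invariant `ω`**: the Koma–Tasaki pair-sourced `t–t'` Hubbard
mean energy (`hubbardTTPrimeSourcedInteraction t t' U μ dWaveFormFactor h`: `e^{tt'} − μρ − 2h Re ω(P₀^d)`) is invariant
under every flip-twisted transform — the «WLOG by averaging» licence of the cell's sourced energy rows.
[cite: KomaTasaki1994, §1] -/
theorem InfVolFermionState.IsTranslationInvariant.meanEnergy_hubbardTTPrimeSourced_twistedFlipAct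
    (hω : ω.IsTranslationInvariant) (g : TwistFlipIndex) (t t' U μ h : ℝ) :
    (ω.twistedFlipAct g).meanEnergy (hubbardTTPrimeSourcedInteraction t t' U μ dWaveFormFactor h) 1 =
      ω.meanEnergy (hubbardTTPrimeSourcedInteraction t t' U μ dWaveFormFactor h) 1 := by
  rw [meanEnergy_hubbardTTPrimeSourced, meanEnergy_hubbardTTPrimeSourced, hω.meanEnergy_hubbardTTPrime_twistedFlipAct,
    twistedFlipAct_density, meanEnergy_pairSourceInteraction_dWave_eq, meanEnergy_pairSourceInteraction_dWave_eq,
    twistedFlipAct_expect_localPairAt_dWave]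

/-- The index set `D₄ × ℤ₂ × ℤ₂` of the flip-twisted transforms has `32` elements. [cite: Han2020Bootstrap, §3] -/
theorem card_twistFlipIndex : Fintype.card TwistFlipIndex = 32 := by rfl

/-- **Orbit average of the sourced mean energy**: `(1/32) Σ_g e^{src}(α_g ω) = e^{src}(ω)` (translation-invariant `ω`).
[cite: KomaTasaki1994, §1] -/
theorem InfVolFermionState.IsTranslationInvariant.sum_meanEnergy_hubbardTTPrimeSourced_twistedFlipAct
    (hω : ω.IsTranslationInvariant) (t t' U μ h : ℝ) :
    ∑ g : TwistFlipIndex, (ω.twistedFlipAct g).meanEnergy (hubbardTTPrimeSourcedInteraction t t' U μ dWaveFormFactor h) 1 =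
      32 * ω.meanEnergy (hubbardTTPrimeSourcedInteraction t t' U μ dWaveFormFactor h) 1 := by
  simp_rw [hω.meanEnergy_hubbardTTPrimeSourced_twistedFlipAct]
  rw [Finset.sum_const, Finset.card_univ, card_twistFlipIndex, nsmul_eq_mul, Nat.cast_ofNat]

/-- **Orbit average of the unsourced mean energy**: `Σ_g e^{tt'}(α_g ω) = 32 e^{tt'}(ω)` (translation-invariant `ω`).
[cite: XuEtAl2024, eq. (1)] -/
theorem InfVolFermionState.IsTranslationInvariant.sum_meanEnergy_hubbardTTPrime_twistedFlipAct
    (hω : ω.IsTranslationInvariant) (t t' U : ℝ) :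
    ∑ g : TwistFlipIndex, (ω.twistedFlipAct g).meanEnergy (hubbardTTPrimeFermionInteraction t t' U) 1 =
      32 * ω.meanEnergy (hubbardTTPrimeFermionInteraction t t' U) 1 := by
  simp_rw [hω.meanEnergy_hubbardTTPrime_twistedFlipAct]
  rw [Finset.sum_const, Finset.card_univ, card_twistFlipIndex, nsmul_eq_mul, Nat.cast_ofNat]

/-- **Orbit average of the local pair amplitude**: `Σ_g Re (α_g ω)(P₀^d) = 32 Re ω(P₀^d)` (every state).
[cite: KomaTasaki1994, §1] -/
theorem InfVolFermionState.sum_re_expect_localPairAt_dWave_twistedFlipAct (ω : InfVolFermionState 2) :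
    ∑ g : TwistFlipIndex, ((ω.twistedFlipAct g).expect (pairRegion (insert (0 : Site 2) unitSteps) 0)
        (localPairAt (insert (0 : Site 2) unitSteps) dWaveFormFactor 0)).re =
      32 * (ω.expect (pairRegion (insert (0 : Site 2) unitSteps) 0)
        (localPairAt (insert (0 : Site 2) unitSteps) dWaveFormFactor 0)).re := by
  simp_rw [twistedFlipAct_expect_localPairAt_dWave]
  rw [Finset.sum_const, Finset.card_univ, card_twistFlipIndex, nsmul_eq_mul, Nat.cast_ofNat]

/-- **Minimisers may be symmetrised**: a flip-twisted transform of a translation-invariant minimiser of the sourced mean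
energy is again one. [cite: BratteliKishimotoRobinson1978, Thm. 2 (condition 2)] -/
theorem InfVolFermionState.IsMeanEnergyMinimiser.twistedFlipAct {t t' U μ h : ℝ}
    (hmin : ω.IsMeanEnergyMinimiser (hubbardTTPrimeSourcedInteraction t t' U μ dWaveFormFactor h) 1) (g : TwistFlipIndex) :
    (ω.twistedFlipAct g).IsMeanEnergyMinimiser (hubbardTTPrimeSourcedInteraction t t' U μ dWaveFormFactor h) 1 := by
  refine ⟨hmin.1.twistedFlipAct g, fun ω' hω' => ?_⟩
  rw [hmin.1.meanEnergy_hubbardTTPrimeSourced_twistedFlipAct]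
  exact hmin.2 ω' hω'

end Invariance

end Literature.MathematicalPhysics.QuantumLattice

end
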